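import Summits.NavierStokesRegularity.NavierStokesRegularity.Theses.ExtremiserTransience
import Summits.NavierStokesRegularity.NavierStokesRegularity.Theorems.ExtremiserTransienceTwoThirdsTypicalSelection
import Summits.NavierStokesRegularity.NavierStokesRegularity.Theorems.ExtremiserTransienceTwoThirdsExtractionLarge
import Summits.NavierStokesRegularity.NavierStokesRegularity.Theorems.ExtremiserTransienceTwoThirdsFirstOrderIdentity
import HarnessLib

/-!
# Route `ExtremiserTransience`, crux `NearExtremalTransiencePerFlow` (stmt-NavierStokesRegularity-26567) —
# PROVED, by LINE g10-1 «two_thirds» (ns-idea-10)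

`--workitem stmt-NavierStokesRegularity-26567` (prover seat ns-net-p2 g13).  The registered skeleton
`Cruxes/NearExtremalTransience/Lines/two_thirds.lean` (REV 1.4) composes the crux BY NAME from its three stubs
(`NearExtremalTransiencePerFlow_of_large`); all three are now Theorems-side theorems with the texts of record as types:

* S1a′ `TwoThirds.typicalSelectionLarge_holds : TypicalSelectionLarge` (p738670, this seat; texts of record p725367),
* S1b′ `TwoThirds.extremalExtractionLarge : ExtremalExtractionLarge` (p726488, ns-net-p2 g12),
* S2 `TwoThirds.firstOrderIdentity_holds : FirstOrderIdentity` (p729338, ns-net-p1 g16).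

This file ports §3 of the skeleton (`clash`, the two-thirds clash of pure real algebra, and `exists_scale`) and its §4 composition
VERBATIM (a Theorems file may not import a `Cruxes/` skeleton) and concludes
`NearExtremalTransiencePerFlow_proof : Summit.NavierStokesRegularity.NavierStokesRegularity.Theses.ExtremiserTransience.NearExtremalTransiencePerFlow`.
Mechanism (the line): a violator of the per-flow near-extremal transience yields (S1a′ + S1b′) an analytic local maximiser of the limit
class carrying, cofinally in the scale, doubling good balls of enstrophy `≥ b₀ > 0` — `δ`-extremal for `κ⋆√(Z_B W_B)` with unit Taylor
ratio and thin layers; the first-order identity at infinity (S2) makes the same balls `3J_B ≈ κ⋆(Z_B + W_B)`-critical; `clash`: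
`J_B ≳ κ⋆ Z_B` and `J_B ≈ (2/3)κ⋆ Z_B` are incompatible once `Z_B ≥ b₀`.
HONEST FRAMING: this closes the crux ⟨26567⟩ of the route `ExtremiserTransience` (one conjunct of the route's `closes`); it does NOT prove
the summit `NavierStokesRegularity` (the route's other cruxes `DepletionCascade`, `NoTypeII` remain); no summit is proved by a line.
-/

noncomputable section

open scoped Topology InnerProductSpace RealInnerProductSpace ENNReal ContDiff
open MeasureTheory Filter Set
open Literature.Analysis.FluidPDE
open Summit.NavierStokesRegularity.NavierStokesRegularity.Theorems.DepletionLadder.KStar.HalfSpace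
open Summit.NavierStokesRegularity.NavierStokesRegularity.Theorems.DepletionLadder.KStar.BangBang
open Summit.NavierStokesRegularity.NavierStokesRegularity.Theorems.NearExtremalTransiencePerFlow.ZoneTransversality
open Summit.NavierStokesRegularity.NavierStokesRegularity.Theorems.NearExtremalTransiencePerFlow.LocalMaximiser
open Summit.NavierStokesRegularity.NavierStokesRegularity.Theses.ExtremiserTransience

namespace Summit.NavierStokesRegularity.NavierStokesRegularity.Theorems

-- the summit's namespace repeats the problem name by convention (D-0017)
set_option linter.dupNamespace false

namespace NearExtremalTransiencePerFlow.TwoThirds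

/-! ## §3 of the skeleton: the two-thirds clash and the choice of scale (ported verbatim) -/

/-- **THE TWO-THIRDS CLASH** (pure real algebra).  For `κ > 0` and `b₀ > 0` there is `ε₁ > 0` such that no reals `J, Z, W` with
`Z ≥ b₀`, `W ≥ 0` can be simultaneously `δ`-EXTREMAL with `δ`-unit Taylor ratio (`κ√(ZW)(1−δ) ≤ J`, `|W − Z| ≤ δZ`) and
`e`-CRITICAL (`|3J − κ(Z + W)| ≤ e(1 + Z + W)`) when `δ, e ≤ ε₁`: the first forces `J ≳ κZ`, the second `J ≈ (2/3)κZ`.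
(Skeleton `Lines/two_thirds.lean` §3, planner ns-idea-10, verbatim.) [folklore] -/
theorem clash {κ b₀ : ℝ} (hκ : 0 < κ) (hb : 0 < b₀) :
    ∃ ε₁ : ℝ, 0 < ε₁ ∧ ∀ (J Z W δ e : ℝ), 0 ≤ δ → δ ≤ ε₁ → 0 ≤ e → e ≤ ε₁ → b₀ ≤ Z → 0 ≤ W →
      κ * Real.sqrt (Z * W) * (1 - δ) ≤ J → |W - Z| ≤ δ * Z → |3 * J - κ * (Z + W)| ≤ e * (1 + Z + W) → False := by
  refine ⟨min (1 / 100) (κ * b₀ / (2 * (1 + 3 * b₀))), lt_min (by norm_num) (by positivity), ?_⟩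
  intro J Z W δ e hδ0 hδ1 he0 he1 hZ hW hext hrat hcrit
  have hδ : δ ≤ 1 / 100 := hδ1.trans (min_le_left _ _)
  have he : e ≤ κ * b₀ / (2 * (1 + 3 * b₀)) := he1.trans (min_le_right _ _)
  have hZ0 : 0 < Z := hb.trans_le hZ
  -- Taylor ratio: (1 - δ) Z ≤ W ≤ (1 + δ) Z
  have hW1 : (1 - δ) * Z ≤ W := by
    have := (abs_le.1 hrat).1; nlinarith
  have hW2 : W ≤ (1 + δ) * Z := by
    have := (abs_le.1 hrat).2; nlinarith
  -- √(ZW) ≥ (1 - δ) Z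
  have h1δ : 0 ≤ 1 - δ := by linarith
  have hsq : (1 - δ) * Z ≤ Real.sqrt (Z * W) := by
    apply Real.le_sqrt_of_sq_le
    have : ((1 - δ) * Z) ^ 2 = (1 - δ) * ((1 - δ) * Z) * Z := by ring
    rw [this]
    have h2 : (1 - δ) * ((1 - δ) * Z) ≤ W := by nlinarith
    nlinarith
  -- extremality: J ≥ κ (1-δ)² Z
  have hJ : κ * ((1 - δ) * Z) * (1 - δ) ≤ J := by
    have : κ * ((1 - δ) * Z) * (1 - δ) ≤ κ * Real.sqrt (Z * W) * (1 - δ) :=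
      mul_le_mul_of_nonneg_right (mul_le_mul_of_nonneg_left hsq hκ.le) h1δ
    exact this.trans hext
  -- criticality: 3J ≤ κ(Z+W) + e(1+Z+W)
  have hC : 3 * J ≤ κ * (Z + W) + e * (1 + Z + W) := by
    have := (abs_le.1 hcrit).2; linarith
  -- combine: 3κ(1-δ)²Z ≤ 3J ≤ κ(2+δ)Z + e(1 + (2+δ)Z) ≤ κ(2+δ)Z + e(1+3Z)
  have hB : κ * W ≤ κ * ((1 + δ) * Z) := mul_le_mul_of_nonneg_left hW2 hκ.le
  have hCC : e * W ≤ e * ((1 + δ) * Z) := mul_le_mul_of_nonneg_left hW2 he0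
  have hD : 0 ≤ e * Z * (1 - δ) := mul_nonneg (mul_nonneg he0 hZ0.le) h1δ
  have hE : 0 ≤ κ * Z * δ ^ 2 := mul_nonneg (mul_nonneg hκ.le hZ0.le) (sq_nonneg δ)
  have hkey : κ * Z * (1 - 7 * δ) ≤ e * (1 + 3 * Z) := by linarith
  -- e(1 + 3Z) ≤ κ Z / 2 using Z ≥ b₀
  have he2 : e * (1 + 3 * Z) ≤ κ * Z / 2 := by
    have h13 : 0 < 1 + 3 * b₀ := by positivity
    have : e * (1 + 3 * Z) ≤ κ * b₀ / (2 * (1 + 3 * b₀)) * (1 + 3 * Z) :=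
      mul_le_mul_of_nonneg_right he (by positivity)
    refine this.trans ?_
    rw [div_mul_eq_mul_div, div_le_iff₀ (by positivity)]
    have := mul_le_mul_of_nonneg_left hZ hκ.le
    linarith
  have hF : 0 < κ * Z * (1 / 2 - 7 * δ) := mul_pos (mul_pos hκ hZ0) (by linarith)
  linarith

/-- Choice of the scale: an index `i` with tolerance `K/(i+1) ≤ t` and `4^i ≥ R₁`. (Skeleton §3, verbatim.) [folklore] -/
theorem exists_scale (K t R₁ : ℝ) (ht : 0 < t) : ∃ i : ℕ, K / (i + 1) ≤ t ∧ R₁ ≤ (4 : ℝ) ^ i := by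
  refine ⟨⌈K / t⌉₊ + ⌈R₁⌉₊, ?_, ?_⟩
  · have h1 : K / t ≤ (⌈K / t⌉₊ : ℝ) := Nat.le_ceil _
    have h2 : (0 : ℝ) ≤ (⌈R₁⌉₊ : ℝ) := Nat.cast_nonneg _
    have hpos : (0 : ℝ) < (⌈K / t⌉₊ + ⌈R₁⌉₊ : ℕ) + 1 := by positivity
    rw [div_le_iff₀ hpos]
    have : K ≤ t * (K / t) := by rw [mul_div_cancel₀ _ ht.ne']
    push_cast
    nlinarith
  · have h1 : R₁ ≤ (⌈R₁⌉₊ : ℝ) := Nat.le_ceil _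
    have h2 : ((⌈K / t⌉₊ + ⌈R₁⌉₊ : ℕ) : ℝ) < (4 : ℝ) ^ (⌈K / t⌉₊ + ⌈R₁⌉₊) := by
      exact_mod_cast Nat.lt_pow_self (by norm_num : 1 < 4)
    have h3 : (⌈R₁⌉₊ : ℝ) ≤ ((⌈K / t⌉₊ + ⌈R₁⌉₊ : ℕ) : ℝ) := by push_cast; linarith [(Nat.cast_nonneg (⌈K / t⌉₊) : (0:ℝ) ≤ _)]
    linarith

/-! ## §4 of the skeleton: the composition (ported verbatim, stubs instantiated by the landed theorems) -/

/-- **THE LINE «two_thirds» CLOSES THE CRUX**: `NearExtremalTransiencePerFlow` from S1a′ (`typicalSelectionLarge_holds`), S1b′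
(`extremalExtractionLarge`) and S2 (`firstOrderIdentity_holds`) — the skeleton's `NearExtremalTransiencePerFlow_of_large` verbatim. -/
theorem nearExtremalTransiencePerFlow_of_two_thirds : NearExtremalTransiencePerFlow := by
  intro C ν T hC hν hT u p hsol hLH hdec hrate hsing
  by_contra hno
  have hviol : IsViolator C ν T u p := ⟨hC, hν, hT, hsol, hLH, hdec, hrate, hsing, hno⟩
  obtain ⟨A, A_E, V, K, b₀, D, hA, hAE, hV, hK, hb₀, hD, hgood⟩ :=
    extremalExtractionLarge typicalSelectionLarge_holds C ν T u p hviol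
  obtain ⟨ε₁, hε₁, hcl⟩ := clash kStar_pos hb₀
  obtain ⟨η, R₁, hη, hR₁, hid⟩ := firstOrderIdentity_holds A A_E V hA hAE hV D ε₁ hD hε₁
  obtain ⟨i₀, hi₀, hi₀R⟩ := exists_scale K (min ε₁ η) R₁ (lt_min hε₁ hη)
  obtain ⟨i, c, r, hii, hr1, hr2, hbr, hdbl, hext, hrat, hlay⟩ := hgood i₀
  -- the tolerance only improves and the radius only grows beyond the chosen scale `i₀`
  have hi : K / (i + 1) ≤ min ε₁ η := by
    refine le_trans ?_ hi₀
    exact div_le_div_of_nonneg_left hK.le (by positivity) (by exact_mod_cast Nat.succ_le_succ hii)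
  have hiR : R₁ ≤ (4 : ℝ) ^ i := hi₀R.trans (pow_le_pow_right₀ (by norm_num) hii)
  have hδ0 : 0 ≤ K / (i + 1) := div_nonneg hK.le (by positivity)
  have hδε : K / (i + 1) ≤ ε₁ := hi.trans (min_le_left _ _)
  have hδη : K / (i + 1) ≤ η := hi.trans (min_le_right _ _)
  have hbulk0 : 0 ≤ Zb V c r + Wb V c r := add_nonneg (Zb_nonneg V c r) (Wb_nonneg V c r)
  have hlay' : (Zb V c (r + r ^ (7 / 8 : ℝ)) + Wb V c (r + r ^ (7 / 8 : ℝ))) - (Zb V c r + Wb V c r)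
      ≤ η * (Zb V c r + Wb V c r) := hlay.trans (mul_le_mul_of_nonneg_right hδη hbulk0)
  have hidr := hid c r (hiR.trans hr1) hdbl hlay'
  exact hcl (Jb V c r) (Zb V c r) (Wb V c r) (K / (i + 1)) ε₁ hδ0 hδε hε₁.le le_rfl hbr (Wb_nonneg V c r) hext hrat hidr

end NearExtremalTransiencePerFlow.TwoThirds

/-- **CRUX ⟨26567⟩ `NearExtremalTransiencePerFlow` OF THE ROUTE `ExtremiserTransience`, PROVED** (by the line «two_thirds»; the type is
the route decl verbatim). -/
theorem NearExtremalTransiencePerFlow_proof :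
    Summit.NavierStokesRegularity.NavierStokesRegularity.Theses.ExtremiserTransience.NearExtremalTransiencePerFlow :=
  NearExtremalTransiencePerFlow.TwoThirds.nearExtremalTransiencePerFlow_of_two_thirds

end Summit.NavierStokesRegularity.NavierStokesRegularity.Theorems

end
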